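import Summits.QuantumFields.BalabanUV.Beta.EriceRemainderEnclosureHistoryRenewalWitness

/-!
# EriceRemainderEnclosureHistoryRenewalWitnessRuns — (E35b) the β-LEVEL WITNESS for the rate row, part 2: the two explicit runs SOLVE
# (0.20) with the digital family, the family meets EVERY binder of (E33g) (NE4 as typed, history moduli with an explicit row cost, sign,
# floor), and the two-run discrepancy one row above the pin is the last stage's amplitude — the witness packaged for every firing pattern

Cell `pub-balaban`, β-function sub-cell, BINDER row D4 «RemainderConst leaves for Bałaban's split» (`HOME/BINDER-OWNERS.md`; owner
lineage `b2b-balaban-beta-an4`; this file by co-owner #2 lineage `b2b-balaban-beta-d4-p2`, generation 37), β-FLOW TEAM duty (1),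
FREEZE (0) honoured (def-free; no new leaf, no new hypothesis shape).  Part 2 of station (E35) over part 1
`EriceRemainderEnclosureHistoryRenewalWitness` (kit, grids, separation) and node U2's `T4CouplingMatching` (`RGEqH`-runs compared
through `disc`, the hypothesis shapes `ScaleShiftRate` ∕ `HistLipschitz` ∕ `EventualLowerH`, `FlowStep.BetaLowerH`).

HONEST FRAMING (page 1, verbatim and binding).  *"Discharging BetaPertH makes Bałaban's UV stability UNCONDITIONAL — a real
constructive-QFT result; it is NOT the continuum limit and NOT the Clay problem."*  THIS FILE DISCHARGES NOTHING OF THE KIND.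
[folklore] real analysis on an EXPLICIT family and two EXPLICIT runs; the binders verified are the cell's NOT-IN-PRINT hypothesis shapes
(GAPS G-t4-U2-1∕-2), here SATISFIED by a witness, never asserted of Bałaban's (1.22).  Row D4 class UNCHANGED (critical-path width 0;
instance 0∕1; D4 DISCHARGE NO DATE); NOT B12 Thm 2, NOT BetaPertH, NOT continuum, NOT Clay.  HONEST DEPENDENCY: continuum YM on T⁴ ⇐
BetaPertH ∧ nine spine estimates (0/9 proved); BetaPertH ⇐ (D1) ∧ (D4) ∧ CAP+tail; G-an2-4 gates asym, D1 and NE2/3/4.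

THE MECHANISM.  Along run A every tent vanishes (part 1 `tentA_zero`), so `β ≡ B₀` there and the grid solves (0.20) (§1 `rgEqH_A`).
Along run B the row `k_t + 1` reads stage `t`'s designated point (tent value `1`) and fires exactly `ε_t = W(k_t + 1) − W(k_t + 2)`,
every other read vanishes (`tentB_zero`), so `1∕(g^B_i)² = Y(K+1−i) − W i` solves (0.20) (§1 `rgEqH_B`); both runs lie in `]0, γ]`
(`x⋆ = 1∕γ²` is the least recursion value) and are pinned at `γ` (`runs_box_pin`).  §2: deleting the finest coupling changes `β` only
through the stage with `a_t = k + 1`, by `≤ ε_t ≤ cθ^k∕(s+1)` — `ScaleShiftRate c θ γ β` (`scaleShiftRate`); the moduli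
`Λ k (k − a_t) = ε_t·L_t` give `HistLipschitz Λ γ β` with every ROW `≤ Σ_t ε_t·L_t` (`histLipschitz_rows`); `b ≤ β` on every box
(`floors`); and `disc gA gB (k_s) = W(k_s + 1) ≥ ε_s` (`eps_le_disc`).  §3 `witness_core` packages all of it for an ARBITRARY firing
pattern with the explicit row cost `(1 + 1∕γ² + (b+c)(k_s+2))³·(ε_0∕b + Σ_{t<s} θ^{a_{t+1}−1}∕θ^{a_t−1})`: each stage costs the cube
of the largest recursion value (the AF weight at the read point, inverted) times the RATIO of consecutive amplitudes — the next file
chooses the pattern so that this is small while the last amplitude beats every geometric `Cκ^{k_s}`.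

WHAT IS PROVED (0 `def`, 0 sorry; [folklore]).  §1 `rgEqH_A`, `rgEqH_B`, `runs_box_pin`; §2 `scaleShiftRate`, `histLipschitz_rows`,
`floors`, `eps_le_disc`; §3 `witness_core`.
-/

noncomputable section
open Finset

namespace Summit.QuantumFields.BalabanUV.Beta.EriceRemainderEnclosureHistoryRenewalWitnessRuns

open Literature.MathematicalPhysics.QuantumFieldTheory.Balaban1983to89
open Literature.MathematicalPhysics.QuantumFieldTheory.Balaban1983to89.FlowStep
open Literature.MathematicalPhysics.QuantumFieldTheory.Balaban1983to89.T4CouplingMatching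
open Literature.MathematicalPhysics.QuantumFieldTheory.Balaban1983to89.T4BetaFlowWellPosed (one_div_sqrt_le)
open Literature.MathematicalPhysics.QuantumFieldTheory.Balaban1983to89.T4BetaFlowWellPosed.Sharpness (one_div_sqrt_pos one_div_one_div_sqrt_sq)
open Summit.QuantumFields.BalabanUV.Beta.EriceRemainderEnclosureHistoryRenewalWitness

/-! ## §1 The two runs solve (0.20) with the digital family -/

/-- **RUN A SOLVES (0.20), CUTOFF `K`.**  With the digital family
`β_{k+1}(v) = B₀ − Σ_t [a_t ≤ k]·ε_t·tent_t(v_{k−a_t})` (tents centred at run B's designated read points), the grid run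
`g^A_i = 1∕√Y(K−i)` solves `1∕(g^A_k)² = 1∕(g^A_{k+1})² + β_{k+1}(g^A_0,…,g^A_k)` for `k < K`: every tent the family reads along run A
vanishes (`tentA_zero`), so `β ≡ B₀` along run A. [folklore] -/
theorem rgEqH_A {c θ γ b : ℝ} {s K : ℕ} {a k : ℕ → ℕ} {ε W Y η L gA gB : ℕ → ℝ} {S B₀ xs Ytop : ℝ} {β : HBeta}
    (hc : 0 < c) (hθ0 : 0 < θ) (hθ1 : θ ≤ 1) (hγ : 0 < γ) (hb : 0 < b)
    (hε : ∀ t, ε t = c * θ ^ (a t - 1) / (s + 1)) (hS : S = ∑ t ∈ range (s + 1), ε t) (hB : B₀ = b + S)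
    (hx : xs = 1 / γ ^ 2) (hY : ∀ m : ℕ, Y m = xs + B₀ * m) (hK : K = k s + 1)
    (hW : ∀ i, W i = ∑ t ∈ range (s + 1), if i ≤ k t + 1 then ε t else 0) (hT : Ytop = xs + (b + c) * (k s + 2))
    (hη0 : η 0 = b) (hηs : ∀ t, η (t + 1) = ε t) (hL : ∀ t, L t = (1 + Ytop) ^ 3 / η t)
    (hgA : ∀ i, gA i = 1 / Real.sqrt (Y (K - i))) (hgB : ∀ i, gB i = 1 / Real.sqrt (Y (K + 1 - i) - W i))
    (hβ : ∀ kk v, β kk v = B₀ - ∑ t ∈ range (s + 1),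
      if a t ≤ kk then ε t * max 0 (1 - L t * |v ⟨kk - a t, Nat.sub_lt_succ kk (a t)⟩ - gB (k t + 1 - a t)|) else 0)
    (ha0 : a 0 = k 0 + 1) (hak : ∀ t, t < s → k (t + 1) = k t + a (t + 1)) (hks : ∀ t, t ≤ s → k t ≤ k s)
    (hka : ∀ t, t ≤ s → a t ≤ k t + 1) (hεb : ∀ t, t ≤ s → ε t ≤ b) :
    RGEqH K β gA := by
  obtain ⟨hxs, -, -, hYlo, -, -, hYsucc⟩ := grid_bounds hc hθ0 hθ1 hγ hb hε hS hB hx hY hT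
  intro kk hkk
  rw [hgA, hgA, one_div_one_div_sqrt_sq (hxs.le.trans (hYlo _)), one_div_one_div_sqrt_sq (hxs.le.trans (hYlo _)), hβ]
  simp only [prefixOf_apply]
  have hsum : ∑ t ∈ range (s + 1),
      (if a t ≤ kk then ε t * max 0 (1 - L t * |gA (kk - a t) - gB (k t + 1 - a t)|) else 0) = 0 := by
    refine sum_eq_zero fun t ht => ?_
    have hts : t ≤ s := Nat.lt_succ_iff.mp (mem_range.mp ht)
    split_ifs with hat
    · rw [tentA_zero hc hθ0 hθ1 hγ hb hε hS hB hx hY hK hW hT hη0 hηs hL hgA hgB ha0 hak hks hka hεb hts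
        (i := kk - a t) (by omega), mul_zero]
    · rfl
  rw [hsum, sub_zero, show K - kk = (K - (kk + 1)) + 1 by omega, hYsucc]

/-- **RUN B SOLVES (0.20), CUTOFF `K + 1`.**  The run `g^B_i = 1∕√(Y(K+1−i) − W i)` sits below the grid by the accumulated firing
`W i = Σ_{t : i ≤ k_t+1} ε_t`; it solves (0.20) for `k ≤ K`: the row `k = k_t + 1` reads the designated point of stage `t` (tent value `1`,
firing `ε_t = W(k_t+1) − W(k_t+2)`), every other read vanishes (`tentB_zero`). [folklore] -/
theorem rgEqH_B {c θ γ b : ℝ} {s K : ℕ} {a k : ℕ → ℕ} {ε W Y η L gB : ℕ → ℝ} {S B₀ xs Ytop : ℝ} {β : HBeta}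
    (hc : 0 < c) (hθ0 : 0 < θ) (hθ1 : θ ≤ 1) (hγ : 0 < γ) (hb : 0 < b)
    (hε : ∀ t, ε t = c * θ ^ (a t - 1) / (s + 1)) (hS : S = ∑ t ∈ range (s + 1), ε t) (hB : B₀ = b + S)
    (hx : xs = 1 / γ ^ 2) (hY : ∀ m : ℕ, Y m = xs + B₀ * m) (hK : K = k s + 1)
    (hW : ∀ i, W i = ∑ t ∈ range (s + 1), if i ≤ k t + 1 then ε t else 0) (hT : Ytop = xs + (b + c) * (k s + 2))
    (hη0 : η 0 = b) (hηs : ∀ t, η (t + 1) = ε t) (hL : ∀ t, L t = (1 + Ytop) ^ 3 / η t)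
    (hgB : ∀ i, gB i = 1 / Real.sqrt (Y (K + 1 - i) - W i))
    (hβ : ∀ kk v, β kk v = B₀ - ∑ t ∈ range (s + 1),
      if a t ≤ kk then ε t * max 0 (1 - L t * |v ⟨kk - a t, Nat.sub_lt_succ kk (a t)⟩ - gB (k t + 1 - a t)|) else 0)
    (hks : ∀ t, t ≤ s → k t ≤ k s) (hka : ∀ t, t ≤ s → a t ≤ k t + 1) (hεb : ∀ t, t ≤ s → ε t ≤ b) :
    RGEqH (K + 1) β gB := by
  obtain ⟨hxs, -, -, hYlo, -, -, hYsucc⟩ := grid_bounds hc hθ0 hθ1 hγ hb hε hS hB hx hY hT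
  have hV := run_values hc hθ0 hθ1 hγ hb hε hS hB hx hY hK hW hT hks
  intro kk hkk
  rw [hgB, hgB, one_div_one_div_sqrt_sq (hxs.le.trans (hV _).2.1), one_div_one_div_sqrt_sq (hxs.le.trans (hV _).2.1), hβ]
  simp only [prefixOf_apply]
  have hWdiff : W kk - W (kk + 1) = ∑ t ∈ range (s + 1),
      (if a t ≤ kk then ε t * max 0 (1 - L t * |gB (kk - a t) - gB (k t + 1 - a t)|) else 0) := by
    rw [hW, hW, ← sum_sub_distrib]
    refine sum_congr rfl fun t ht => ?_
    have hts : t ≤ s := Nat.lt_succ_iff.mp (mem_range.mp ht)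
    have hkat := hka t hts
    rcases lt_trichotomy kk (k t + 1) with hlt | heq | hgt
    · rw [if_pos (by omega), if_pos (by omega), sub_self]
      split_ifs with hat
      · rw [tentB_zero hc hθ0 hθ1 hγ hb hε hS hB hx hY hK hW hT hη0 hηs hL hgB hks hεb hts
          (i := kk - a t) (by omega) (by omega), mul_zero]
      · rfl
    · rw [if_pos (by omega), if_neg (by omega), sub_zero, if_pos (by omega),
        show kk - a t = k t + 1 - a t by omega, tent_self, mul_one]
    · rw [if_neg (by omega), if_neg (by omega), sub_self, if_pos (by omega),
        tentB_zero hc hθ0 hθ1 hγ hb hε hS hB hx hY hK hW hT hη0 hηs hL hgB hks hεb hts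
          (i := kk - a t) (by omega) (by omega), mul_zero]
  rw [← hWdiff, show K + 1 - kk = (K + 1 - (kk + 1)) + 1 by omega, hYsucc]
  ring

/-- **BOXES AND PIN.**  Both runs lie in `]0, γ]` (`x⋆ = 1∕γ²` is the smallest recursion value), and they are pinned:
`g^A_K = g^B_{K+1} = γ`. [folklore] -/
theorem runs_box_pin {c θ γ b : ℝ} {s K : ℕ} {a k : ℕ → ℕ} {ε W Y gA gB : ℕ → ℝ} {S B₀ xs Ytop : ℝ}
    (hc : 0 < c) (hθ0 : 0 < θ) (hθ1 : θ ≤ 1) (hγ : 0 < γ) (hb : 0 < b)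
    (hε : ∀ t, ε t = c * θ ^ (a t - 1) / (s + 1)) (hS : S = ∑ t ∈ range (s + 1), ε t) (hB : B₀ = b + S)
    (hx : xs = 1 / γ ^ 2) (hY : ∀ m : ℕ, Y m = xs + B₀ * m) (hK : K = k s + 1)
    (hW : ∀ i, W i = ∑ t ∈ range (s + 1), if i ≤ k t + 1 then ε t else 0) (hT : Ytop = xs + (b + c) * (k s + 2))
    (hgA : ∀ i, gA i = 1 / Real.sqrt (Y (K - i))) (hgB : ∀ i, gB i = 1 / Real.sqrt (Y (K + 1 - i) - W i))
    (hks : ∀ t, t ≤ s → k t ≤ k s) :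
    (∀ i, i ≤ K → 0 < gA i ∧ gA i ≤ γ) ∧ (∀ i, i ≤ K + 1 → 0 < gB i ∧ gB i ≤ γ) ∧ gA K = gB (K + 1) := by
  obtain ⟨hxs, -, -, hYlo, -, -, -⟩ := grid_bounds hc hθ0 hθ1 hγ hb hε hS hB hx hY hT
  have hV := run_values hc hθ0 hθ1 hγ hb hε hS hB hx hY hK hW hT hks
  refine ⟨fun i _ => ?_, fun i _ => ?_, ?_⟩
  · rw [hgA]
    exact ⟨one_div_sqrt_pos (hxs.trans_le (hV i).1.1), one_div_sqrt_le hγ (hx ▸ (hV i).1.1)⟩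
  · rw [hgB]
    exact ⟨one_div_sqrt_pos (hxs.trans_le (hV i).2.1), one_div_sqrt_le hγ (hx ▸ (hV i).2.1)⟩
  · rw [hgA, hgB, W_eq_zero hW hks (show k s + 2 ≤ K + 1 by omega), sub_zero, Nat.sub_self,
      show K + 1 - (K + 1) = 0 by omega]

/-! ## §2 The binder list of (E33g) -/

/-- **NE4 AS TYPED.**  The digital family has `ScaleShiftRate c θ γ β`: deleting the finest coupling `w_0` from a history of length `k + 2`
changes `β` only through the tent of the stage `t` with `a_t = k + 1` (if any), by at most `ε_t = cθ^{a_t−1}∕(s+1)`; summed over the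
`s + 1` stages this is `≤ cθ^k`. [folklore] -/
theorem scaleShiftRate {c θ γ b : ℝ} {s : ℕ} {a k : ℕ → ℕ} {ε η L gB : ℕ → ℝ} {B₀ Ytop : ℝ} {β : HBeta}
    (hc : 0 < c) (hθ0 : 0 < θ) (hb : 0 < b)
    (hε : ∀ t, ε t = c * θ ^ (a t - 1) / (s + 1))
    (hη0 : η 0 = b) (hηs : ∀ t, η (t + 1) = ε t) (hL : ∀ t, L t = (1 + Ytop) ^ 3 / η t) (hYtop : 0 ≤ Ytop)
    (hβ : ∀ kk v, β kk v = B₀ - ∑ t ∈ range (s + 1),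
      if a t ≤ kk then ε t * max 0 (1 - L t * |v ⟨kk - a t, Nat.sub_lt_succ kk (a t)⟩ - gB (k t + 1 - a t)|) else 0) :
    ScaleShiftRate c θ γ β := by
  have hp := eps_pos hc hθ0 hε
  have hLpos : ∀ t, 0 ≤ L t := fun t => by
    rw [hL]; refine div_nonneg (by positivity) ?_
    cases t with
    | zero => rw [hη0]; exact hb.le
    | succ t => rw [hηs]; exact (hp t).le
  intro kk w _hw
  rw [hβ, hβ, sub_sub_sub_cancel_left, ← sum_sub_distrib]
  calc |∑ t ∈ range (s + 1), ((if a t ≤ kk then ε t * max 0 (1 - L t *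
            |Fin.tail w ⟨kk - a t, Nat.sub_lt_succ kk (a t)⟩ - gB (k t + 1 - a t)|) else 0) -
          (if a t ≤ kk + 1 then ε t * max 0 (1 - L t *
            |w ⟨kk + 1 - a t, Nat.sub_lt_succ (kk + 1) (a t)⟩ - gB (k t + 1 - a t)|) else 0))|
      ≤ ∑ t ∈ range (s + 1), |(if a t ≤ kk then ε t * max 0 (1 - L t *
            |Fin.tail w ⟨kk - a t, Nat.sub_lt_succ kk (a t)⟩ - gB (k t + 1 - a t)|) else 0) -
          (if a t ≤ kk + 1 then ε t * max 0 (1 - L t *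
            |w ⟨kk + 1 - a t, Nat.sub_lt_succ (kk + 1) (a t)⟩ - gB (k t + 1 - a t)|) else 0)| :=
        abs_sum_le_sum_abs _ _
    _ ≤ ∑ _t ∈ range (s + 1), c * θ ^ kk / (s + 1) := by
        refine sum_le_sum fun t _ => ?_
        by_cases h1 : a t ≤ kk
        · have e : Fin.tail w ⟨kk - a t, Nat.sub_lt_succ kk (a t)⟩ = w ⟨kk + 1 - a t, Nat.sub_lt_succ (kk + 1) (a t)⟩ := by
            simp only [Fin.tail, Fin.succ_mk]
            exact congrArg w (Fin.ext (by simp; omega))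
          rw [if_pos h1, if_pos (by omega), e, sub_self, abs_zero]; positivity
        · by_cases h2 : a t = kk + 1
          · have hεt : ε t = c * θ ^ kk / (s + 1) := by rw [hε, h2, Nat.add_sub_cancel]
            rw [if_neg h1, if_pos h2.le, zero_sub, abs_neg, abs_of_nonneg (mul_nonneg (hp t).le (tent_nonneg _ _ _)), hεt]
            exact mul_le_of_le_one_right (by positivity) (tent_le_one (hLpos t) _ _)
          · rw [if_neg h1, if_neg (by omega), sub_zero, abs_zero]; positivity
    _ = c * θ ^ kk := by rw [sum_const, card_range, nsmul_eq_mul]; push_cast; field_simp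

/-- **HISTORY MODULI WITH FINITE ROWS.**  The digital family is `HistLipschitz Λ γ β` for the moduli `Λ k i = ε_t·L_t` at the read
coordinates `i = k − a_t` (`a_t ≤ k`) and `0` elsewhere; `Λ ≥ 0`, and every ROW total is at most the stage cost `Σ_t ε_t·L_t`. [folklore] -/
theorem histLipschitz_rows {c θ γ b : ℝ} {s : ℕ} {a k : ℕ → ℕ} {ε η L gB : ℕ → ℝ} {B₀ Ytop : ℝ} {β : HBeta} {Λ : ℕ → ℕ → ℝ}
    (hc : 0 < c) (hθ0 : 0 < θ) (hb : 0 < b)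
    (hε : ∀ t, ε t = c * θ ^ (a t - 1) / (s + 1))
    (hη0 : η 0 = b) (hηs : ∀ t, η (t + 1) = ε t) (hL : ∀ t, L t = (1 + Ytop) ^ 3 / η t) (hYtop : 0 ≤ Ytop)
    (hβ : ∀ kk v, β kk v = B₀ - ∑ t ∈ range (s + 1),
      if a t ≤ kk then ε t * max 0 (1 - L t * |v ⟨kk - a t, Nat.sub_lt_succ kk (a t)⟩ - gB (k t + 1 - a t)|) else 0)
    (hΛ : ∀ kk i, Λ kk i = ∑ t ∈ range (s + 1), if i = kk - a t then (if a t ≤ kk then ε t * L t else 0) else 0) :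
    HistLipschitz Λ γ β ∧ (∀ kk i, i ≤ kk → 0 ≤ Λ kk i) ∧
      ∀ kk, ∑ i ∈ range (kk + 1), Λ kk i ≤ ∑ t ∈ range (s + 1), ε t * L t := by
  have hp := eps_pos hc hθ0 hε
  have hLpos : ∀ t, 0 ≤ L t := fun t => by
    rw [hL]; refine div_nonneg (by positivity) ?_
    cases t with
    | zero => rw [hη0]; exact hb.le
    | succ t => rw [hηs]; exact (hp t).le
  have hc0 : ∀ t kk, (0 : ℝ) ≤ if a t ≤ kk then ε t * L t else 0 := fun t kk => by
    split_ifs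
    · exact mul_nonneg (hp t).le (hLpos t)
    · exact le_rfl
  refine ⟨?_, fun kk i _ => ?_, fun kk => ?_⟩
  · intro kk p q _ _
    have hR : ∑ i : Fin (kk + 1), Λ kk i * |p i - q i| = ∑ t ∈ range (s + 1),
        if a t ≤ kk then ε t * L t * |p ⟨kk - a t, Nat.sub_lt_succ kk (a t)⟩ - q ⟨kk - a t, Nat.sub_lt_succ kk (a t)⟩| else 0 := by
      simp_rw [hΛ, sum_mul]
      rw [sum_comm]
      refine sum_congr rfl fun t _ => ?_
      rw [Finset.sum_eq_single ⟨kk - a t, Nat.sub_lt_succ kk (a t)⟩]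
      · rw [if_pos rfl]
        split_ifs
        · rfl
        · exact zero_mul _
      · intro i _ hi
        rw [if_neg (fun h => hi (Fin.ext h)), zero_mul]
      · intro h; exact absurd (mem_univ _) h
    rw [hR, hβ, hβ, sub_sub_sub_cancel_left, ← sum_sub_distrib]
    refine (abs_sum_le_sum_abs _ _).trans (sum_le_sum fun t _ => ?_)
    split_ifs with hat
    · rw [← mul_sub, abs_mul, abs_of_nonneg (hp t).le, mul_assoc]
      refine mul_le_mul_of_nonneg_left ?_ (hp t).le
      rw [abs_sub_comm (p _) (q _)]
      exact abs_tent_sub_tent_le (hLpos t) _ _ _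
    · rw [sub_self, abs_zero]
  · rw [hΛ]
    exact sum_nonneg fun t _ => by split_ifs <;> first | exact mul_nonneg (hp t).le (hLpos t) | exact le_rfl
  · simp_rw [hΛ]
    rw [sum_comm]
    refine sum_le_sum fun t _ => ?_
    rw [sum_ite_eq' (range (kk + 1)) (kk - a t), if_pos (mem_range.mpr (Nat.sub_lt_succ kk (a t)))]
    split_ifs
    · exact le_rfl
    · exact mul_nonneg (hp t).le (hLpos t)

/-- **SIGN AND FLOOR.**  Along every history in the box the digital family satisfies `b ≤ β` (hence `0 ≤ β`): the tents are valued in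
`[0, 1]` and `B₀ − Σ_t ε_t = b`.  So `BetaLowerH 0 γ β` and `EventualLowerH b γ 0 β`. [folklore] -/
theorem floors {c θ γ b : ℝ} {s : ℕ} {a k : ℕ → ℕ} {ε η L gB : ℕ → ℝ} {S B₀ Ytop : ℝ} {β : HBeta}
    (hc : 0 < c) (hθ0 : 0 < θ) (hb : 0 < b)
    (hε : ∀ t, ε t = c * θ ^ (a t - 1) / (s + 1)) (hS : S = ∑ t ∈ range (s + 1), ε t) (hB : B₀ = b + S)
    (hη0 : η 0 = b) (hηs : ∀ t, η (t + 1) = ε t) (hL : ∀ t, L t = (1 + Ytop) ^ 3 / η t) (hYtop : 0 ≤ Ytop)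
    (hβ : ∀ kk v, β kk v = B₀ - ∑ t ∈ range (s + 1),
      if a t ≤ kk then ε t * max 0 (1 - L t * |v ⟨kk - a t, Nat.sub_lt_succ kk (a t)⟩ - gB (k t + 1 - a t)|) else 0) :
    BetaLowerH 0 γ β ∧ EventualLowerH b γ 0 β := by
  have hp := eps_pos hc hθ0 hε
  have hLpos : ∀ t, 0 ≤ L t := fun t => by
    rw [hL]; refine div_nonneg (by positivity) ?_
    cases t with
    | zero => rw [hη0]; exact hb.le
    | succ t => rw [hηs]; exact (hp t).le
  have key : ∀ kk v, b ≤ β kk v := fun kk v => by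
    rw [hβ]
    have : ∑ t ∈ range (s + 1), (if a t ≤ kk then
        ε t * max 0 (1 - L t * |v ⟨kk - a t, Nat.sub_lt_succ kk (a t)⟩ - gB (k t + 1 - a t)|) else 0) ≤ S := by
      rw [hS]
      refine sum_le_sum fun t _ => ?_
      split_ifs
      · exact mul_le_of_le_one_right (hp t).le (tent_le_one (hLpos t) _ _)
      · exact (hp t).le
    linarith
  exact ⟨fun kk v _ => hb.le.trans (key kk v), fun kk v _ _ => key kk v⟩

/-- **THE DISCREPANCY AT THE LAST FIRING ROW.**  At `j = k_s` (one row above the pin) the two-run discrepancy is the accumulated firing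
`W(k_s + 1) ≥ ε_s = cθ^{a_s − 1}∕(s+1)`. [folklore] -/
theorem eps_le_disc {c θ γ b : ℝ} {s K : ℕ} {a k : ℕ → ℕ} {ε W Y gA gB : ℕ → ℝ} {S B₀ xs Ytop : ℝ}
    (hc : 0 < c) (hθ0 : 0 < θ) (hθ1 : θ ≤ 1) (hγ : 0 < γ) (hb : 0 < b)
    (hε : ∀ t, ε t = c * θ ^ (a t - 1) / (s + 1)) (hS : S = ∑ t ∈ range (s + 1), ε t) (hB : B₀ = b + S)
    (hx : xs = 1 / γ ^ 2) (hY : ∀ m : ℕ, Y m = xs + B₀ * m) (hK : K = k s + 1)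
    (hW : ∀ i, W i = ∑ t ∈ range (s + 1), if i ≤ k t + 1 then ε t else 0) (hT : Ytop = xs + (b + c) * (k s + 2))
    (hgA : ∀ i, gA i = 1 / Real.sqrt (Y (K - i))) (hgB : ∀ i, gB i = 1 / Real.sqrt (Y (K + 1 - i) - W i))
    (hks : ∀ t, t ≤ s → k t ≤ k s) :
    ε s ≤ disc gA gB (k s) := by
  obtain ⟨hxs, -, -, hYlo, -, -, -⟩ := grid_bounds hc hθ0 hθ1 hγ hb hε hS hB hx hY hT
  have hV := run_values hc hθ0 hθ1 hγ hb hε hS hB hx hY hK hW hT hks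
  unfold disc
  rw [hgA, hgB, one_div_one_div_sqrt_sq (hxs.le.trans (hYlo _)), one_div_one_div_sqrt_sq (hxs.le.trans (hV _).2.1),
    show K - k s = K + 1 - (k s + 1) by omega, sub_sub_cancel,
    abs_of_nonneg (W_bounds (k := k) hc hθ0 hε hS hW _).1]
  exact eps_le_W hc hθ0 hε hW le_rfl le_rfl

/-! ## §3 The witness, packaged -/

/-- **THE β-LEVEL WITNESS (core form).**  For all constants `c, θ, γ, b > 0` (`θ ≤ 1`) and every FIRING PATTERN — stages `t = 0, …, s`
with ages `a_t` and rows `k_t`, `a_0 = k_0 + 1` (the seed reads run B's bare coupling), `k_{t+1} = k_t + a_{t+1}` (stage `t + 1` reads the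
row of stage `t`), amplitudes `ε_t = cθ^{a_t−1}∕(s+1) ≤ b` — there are a history family `β` (stationary, additive along histories: a
constant Markov part `B₀ = b + Σ_t ε_t` minus finitely many tent profiles of the past couplings), moduli `Λ`, and two runs `gA` (cutoff
`K = k_s + 1`) and `gB` (cutoff `K + 1`) of (0.20), pinned and in the box, satisfying EVERY binder of (E33g) `disc_le_sqrt_uniform_sign`
— `ScaleShiftRate c θ γ β`, `HistLipschitz Λ γ β`, `Λ ≥ 0`, rows bounded by the explicit stage cost
`(1 + 1∕γ² + (b+c)(k_s+2))³·(ε_0∕b + Σ_{t<s} θ^{a_{t+1}−1}∕θ^{a_t−1})`, `BetaLowerH 0 γ β`, `EventualLowerH b γ 0 β` — whose two-run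
discrepancy at `j = k_s` is at least `ε_s = cθ^{a_s−1}∕(s+1)`.  Every hypothesis shape on `β` is an UNPRINTED input of the cell
(GAPS G-t4-U2-1∕-2); nothing of [I] (1.22) is asserted. [cite: Balaban1987RG1, (0.20) p.256 and §5 p.298] -/
theorem witness_core {c θ γ b : ℝ} (hc : 0 < c) (hθ0 : 0 < θ) (hθ1 : θ ≤ 1) (hγ : 0 < γ) (hb : 0 < b)
    {s : ℕ} {a k : ℕ → ℕ} (ha0 : a 0 = k 0 + 1) (hak : ∀ t, t < s → k (t + 1) = k t + a (t + 1))
    (hεb : ∀ t, t ≤ s → c * θ ^ (a t - 1) / (s + 1) ≤ b) :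
    ∃ (β : HBeta) (Λ : ℕ → ℕ → ℝ) (gA gB : ℕ → ℝ),
      RGEqH (k s + 1) β gA ∧ RGEqH (k s + 1 + 1) β gB ∧
      (∀ i, i ≤ k s + 1 → 0 < gA i ∧ gA i ≤ γ) ∧ (∀ i, i ≤ k s + 1 + 1 → 0 < gB i ∧ gB i ≤ γ) ∧
      gA (k s + 1) = gB (k s + 1 + 1) ∧
      ScaleShiftRate c θ γ β ∧ HistLipschitz Λ γ β ∧ (∀ kk i, i ≤ kk → 0 ≤ Λ kk i) ∧
      (∀ kk, ∑ i ∈ range (kk + 1), Λ kk i ≤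
        (1 + (1 / γ ^ 2 + (b + c) * (k s + 2))) ^ 3 *
          (c * θ ^ (a 0 - 1) / (s + 1) / b + ∑ t ∈ range s, θ ^ (a (t + 1) - 1) / θ ^ (a t - 1))) ∧
      BetaLowerH 0 γ β ∧ EventualLowerH b γ 0 β ∧
      c * θ ^ (a s - 1) / (s + 1) ≤ disc gA gB (k s) := by
  -- pattern consequences
  have hmono : ∀ n t, t + n ≤ s → k t ≤ k (t + n) := by
    intro n
    induction n with
    | zero => intro t _; simp
    | succ n ih =>
      intro t h
      have h1 := ih t (by omega)
      have h2 := hak (t + n) (by omega)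
      rw [← add_assoc, h2]; omega
  have hks : ∀ t, t ≤ s → k t ≤ k s := fun t ht => by
    have := hmono (s - t) t (by omega); rwa [Nat.add_sub_cancel' ht] at this
  have hka : ∀ t, t ≤ s → a t ≤ k t + 1 := by
    intro t ht
    cases t with
    | zero => omega
    | succ t => have := hak t (by omega); omega
  -- the data, by defining equations
  obtain ⟨ε, hε⟩ : ∃ ε : ℕ → ℝ, ∀ t, ε t = c * θ ^ (a t - 1) / (s + 1) := ⟨_, fun _ => rfl⟩
  obtain ⟨S, hS⟩ : ∃ S : ℝ, S = ∑ t ∈ range (s + 1), ε t := ⟨_, rfl⟩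
  obtain ⟨B₀, hB⟩ : ∃ B₀ : ℝ, B₀ = b + S := ⟨_, rfl⟩
  obtain ⟨xs, hx⟩ : ∃ xs : ℝ, xs = 1 / γ ^ 2 := ⟨_, rfl⟩
  obtain ⟨Y, hY⟩ : ∃ Y : ℕ → ℝ, ∀ m : ℕ, Y m = xs + B₀ * m := ⟨_, fun _ => rfl⟩
  obtain ⟨W, hW⟩ : ∃ W : ℕ → ℝ, ∀ i, W i = ∑ t ∈ range (s + 1), if i ≤ k t + 1 then ε t else 0 := ⟨_, fun _ => rfl⟩
  obtain ⟨Ytop, hT⟩ : ∃ Ytop : ℝ, Ytop = xs + (b + c) * (k s + 2) := ⟨_, rfl⟩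
  obtain ⟨η, hη0, hηs⟩ : ∃ η : ℕ → ℝ, η 0 = b ∧ ∀ t, η (t + 1) = ε t :=
    ⟨fun t => Nat.casesOn t b (fun t' => ε t'), rfl, fun _ => rfl⟩
  obtain ⟨L, hL⟩ : ∃ L : ℕ → ℝ, ∀ t, L t = (1 + Ytop) ^ 3 / η t := ⟨_, fun _ => rfl⟩
  obtain ⟨gA, hgA⟩ : ∃ gA : ℕ → ℝ, ∀ i, gA i = 1 / Real.sqrt (Y (k s + 1 - i)) := ⟨_, fun _ => rfl⟩
  obtain ⟨gB, hgB⟩ : ∃ gB : ℕ → ℝ, ∀ i, gB i = 1 / Real.sqrt (Y (k s + 1 + 1 - i) - W i) := ⟨_, fun _ => rfl⟩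
  obtain ⟨β, hβ⟩ : ∃ β : HBeta, ∀ kk v, β kk v = B₀ - ∑ t ∈ range (s + 1),
      if a t ≤ kk then ε t * max 0 (1 - L t * |v ⟨kk - a t, Nat.sub_lt_succ kk (a t)⟩ - gB (k t + 1 - a t)|) else 0 :=
    ⟨fun kk v => _, fun _ _ => rfl⟩
  obtain ⟨Λ, hΛ⟩ : ∃ Λ : ℕ → ℕ → ℝ, ∀ kk i, Λ kk i = ∑ t ∈ range (s + 1),
      if i = kk - a t then (if a t ≤ kk then ε t * L t else 0) else 0 := ⟨_, fun _ _ => rfl⟩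
  have hεb' : ∀ t, t ≤ s → ε t ≤ b := fun t ht => (hε t).symm ▸ hεb t ht
  obtain ⟨hxs, -, -, -, -, -, -⟩ := grid_bounds hc hθ0 hθ1 hγ hb hε hS hB hx hY hT
  have hYtop : 0 ≤ Ytop := by rw [hT]; positivity
  obtain ⟨hAbox, hBbox, hpin⟩ := runs_box_pin hc hθ0 hθ1 hγ hb hε hS hB hx hY rfl hW hT hgA hgB hks
  obtain ⟨hHL, hΛ0, hrows⟩ := histLipschitz_rows (γ := γ) hc hθ0 hb hε hη0 hηs hL hYtop hβ hΛ
  obtain ⟨hsign, hfloor⟩ := floors (γ := γ) hc hθ0 hb hε hS hB hη0 hηs hL hYtop hβ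
  -- the stage cost, explicitly
  have hcost : ∑ t ∈ range (s + 1), ε t * L t = (1 + (1 / γ ^ 2 + (b + c) * (k s + 2))) ^ 3 *
      (c * θ ^ (a 0 - 1) / (s + 1) / b + ∑ t ∈ range s, θ ^ (a (t + 1) - 1) / θ ^ (a t - 1)) := by
    have hp := eps_pos hc hθ0 hε
    rw [sum_range_succ', hL, hη0, mul_add, mul_sum, add_comm]
    congr 1
    · rw [hε, hT, hx]; ring
    · refine sum_congr rfl fun t _ => ?_
      rw [hL, hηs, hT, hx, hε, hε]
      have h1 : (0 : ℝ) < θ ^ (a t - 1) := by positivity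
      have h2 : (0 : ℝ) < (s : ℝ) + 1 := by positivity
      field_simp
  refine ⟨β, Λ, gA, gB,
    rgEqH_A hc hθ0 hθ1 hγ hb hε hS hB hx hY rfl hW hT hη0 hηs hL hgA hgB hβ ha0 hak hks hka hεb',
    rgEqH_B hc hθ0 hθ1 hγ hb hε hS hB hx hY rfl hW hT hη0 hηs hL hgB hβ hks hka hεb',
    hAbox, hBbox, hpin, scaleShiftRate (γ := γ) hc hθ0 hb hε hη0 hηs hL hYtop hβ, hHL, hΛ0,
    fun kk => (hrows kk).trans (le_of_eq hcost), hsign, hfloor, ?_⟩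
  rw [← hε]
  exact eps_le_disc hc hθ0 hθ1 hγ hb hε hS hB hx hY rfl hW hT hgA hgB hks

end Summit.QuantumFields.BalabanUV.Beta.EriceRemainderEnclosureHistoryRenewalWitnessRuns

end
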